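import Mathlib
import Summits.ValiantsHypothesis.ValiantsHypothesis.Theorems.LacunarySymmetroidMatrixDescartesCensusDefs

/-!
# Descartes is SHARP on every support: the class budget is at least `m·(K−1)` on every exponent vector

For every injective exponent vector `d : Fin K → ℕ` (`K ≥ 2`) and every size `m ≥ 1` there is a symmetric (indeed DIAGONAL) lacunary pencil
`Σₗ X^{dₗ} Sₗ` of size `m` whose determinant has at least `m·(K−1)` distinct positive zeros: `¬ PosRootLawOn m K (m·(K−1) − 1) d`
(`not_posRootLawOn_diagonal`); at `m = 1`: `¬ PosRootLawOn 1 K (K−2) d` (`not_posRootLawOn_one`) — a `K`-nomial on ANY prescribed support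
with `K − 1` prescribed distinct positive zeros exists (`exists_fewnomial_vanishing`: `K` unknown coefficients, `K − 1` homogeneous linear conditions,
`LinearMap.ker_ne_bot_of_finrank_lt`; it is not the zero polynomial because the exponents are distinct, `fewnomial_ne_zero`), and a diagonal
design multiplies `m` of them with pairwise disjoint zero sets.

Asked for by the LINE (B) planner (val-idea-24 g0, bus 19:08:50Z: «the missing lemma is “Descartes is sharp on every finite support” in
`¬ PosRootLawOn 1 K (K−2) d` form, worth having on its own») as the kernel form of step (2) of lift-p3 g17's located refutation of the
support-level reading of T5 (evidence #59 on stmt-ValiantsHypothesis-19561).  Def-free; Mathlib + `…CensusDefs`.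
HONEST FRAMING: an elementary lower bound on the census currency (the trivial diagonal designs); nothing on `WeakLifting`, Conjecture B,
`MatrixDescartes` (18050) or `VP ≠ VNP`.  Seat: prover val-sym-lift-p2 g18, `--supports stmt-ValiantsHypothesis-19561`.
-/

-- `Summit.ValiantsHypothesis.ValiantsHypothesis.…` repeats a component by the D-0017 layout
-- (single-conjunct summit), which the `dupNamespace` linter flags; the name is mandated.
set_option linter.dupNamespace false

namespace Summit.ValiantsHypothesis.ValiantsHypothesis.Theorems.LacunarySymmetroidMatrixDescartes.DescartesSharp

open Finset Polynomial Matrix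
open scoped BigOperators Polynomial
open Summit.ValiantsHypothesis.ValiantsHypothesis.Theorems.LacunarySymmetroidMatrixDescartes (PosRootLawOn)

variable {K : ℕ}

/-- **interpolation count**: on any `K ≥ 1` exponents there is a NON-ZERO coefficient vector whose fewnomial vanishes at `K − 1` prescribed
points (more unknowns than homogeneous equations). [folklore] -/
theorem exists_fewnomial_vanishing (hK : 1 ≤ K) (d : Fin K → ℕ) (t : Fin (K - 1) → ℝ) :
    ∃ c : Fin K → ℝ, c ≠ 0 ∧ ∀ j, ∑ l, t j ^ d l * c l = 0 := by
  set M : Matrix (Fin (K - 1)) (Fin K) ℝ := Matrix.of fun j l => t j ^ d l with hM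
  have hlt : Module.finrank ℝ (Fin (K - 1) → ℝ) < Module.finrank ℝ (Fin K → ℝ) := by
    rw [Module.finrank_fin_fun, Module.finrank_fin_fun]; omega
  have hker := LinearMap.ker_ne_bot_of_finrank_lt (f := Matrix.mulVecLin M) hlt
  obtain ⟨c, hc, hc0⟩ := (Submodule.ne_bot_iff _).mp hker
  refine ⟨c, hc0, fun j => ?_⟩
  have h := congrFun (LinearMap.mem_ker.mp hc) j
  simpa [Matrix.mulVecLin_apply, Matrix.mulVec, dotProduct, hM] using h

/-- a fewnomial with DISTINCT exponents and a non-zero coefficient vector is not the zero polynomial. [folklore] -/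
theorem fewnomial_ne_zero {d : Fin K → ℕ} (hd : Function.Injective d) {c : Fin K → ℝ} (hc : c ≠ 0) :
    (∑ l, (X : ℝ[X]) ^ d l * Polynomial.C (c l)) ≠ 0 := by
  obtain ⟨l₀, hl₀⟩ := Function.ne_iff.mp hc
  intro h0
  have hcoeff : (∑ l, (X : ℝ[X]) ^ d l * Polynomial.C (c l)).coeff (d l₀) = c l₀ := by
    rw [Polynomial.finsetSum_coeff]
    rw [Finset.sum_eq_single l₀ (fun l _ hl => ?_) (fun h => absurd (Finset.mem_univ l₀) h)]
    · rw [mul_comm, Polynomial.coeff_C_mul_X_pow, if_pos rfl]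
    · rw [mul_comm, Polynomial.coeff_C_mul_X_pow, if_neg (fun e => hl (hd e.symm))]
  rw [h0, Polynomial.coeff_zero] at hcoeff
  exact hl₀ hcoeff.symm

/-- a diagonal pencil is the diagonal of its entry fewnomials. [folklore] -/
theorem pencil_diagonal {m : ℕ} (d : Fin K → ℕ) (c : Fin m → Fin K → ℝ) :
    (∑ l, ((X : ℝ[X]) ^ d l) • (Matrix.diagonal fun i => c i l).map Polynomial.C) =
      Matrix.diagonal fun i => ∑ l, (X : ℝ[X]) ^ d l * Polynomial.C (c i l) := by
  ext i j
  simp only [Matrix.sum_apply, Matrix.smul_apply, Matrix.map_apply, Matrix.diagonal_apply, smul_eq_mul]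
  split_ifs with h
  · rfl
  · simp

/-- **DESCARTES IS SHARP ON EVERY SUPPORT (diagonal designs)**: for an injective exponent vector `d` with `K ≥ 2` letters and size `m ≥ 1`
some symmetric (diagonal) pencil on `d` has at least `m·(K−1)` distinct positive determinant zeros, so `¬ PosRootLawOn m K (m·(K−1) − 1) d`.
[this work] -/
theorem not_posRootLawOn_diagonal {m : ℕ} (hm : 1 ≤ m) (hK : 2 ≤ K) {d : Fin K → ℕ} (hd : Function.Injective d) :
    ¬ PosRootLawOn m K (m * (K - 1) - 1) d := by
  classical
  intro hlaw
  -- distinct positive points, `K − 1` of them per row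
  set pt : Fin m × Fin (K - 1) → ℝ := fun ij => ((finProdFinEquiv ij : Fin (m * (K - 1))) : ℕ) + 1 with hpt
  have hpt_inj : Function.Injective pt := by
    intro x y h
    have h1 : (((finProdFinEquiv x : Fin (m * (K - 1))) : ℕ) : ℝ) = ((finProdFinEquiv y : Fin (m * (K - 1))) : ℕ) := by
      simpa [hpt] using h
    exact finProdFinEquiv.injective (Fin.ext (by exact_mod_cast h1))
  have hpt_pos : ∀ ij, 0 < pt ij := fun ij => by simp only [hpt]; positivity
  -- row coefficient vectors
  have hrows := fun i : Fin m => exists_fewnomial_vanishing (by omega) d (fun j => pt (i, j))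
  choose c hc0 hc using hrows
  set p : Fin m → ℝ[X] := fun i => ∑ l, (X : ℝ[X]) ^ d l * Polynomial.C (c i l) with hp
  have hp_ne : ∀ i, p i ≠ 0 := fun i => fewnomial_ne_zero hd (hc0 i)
  have hprod_ne : ∏ i, p i ≠ 0 := Finset.prod_ne_zero_iff.mpr fun i _ => hp_ne i
  -- the diagonal design and its determinant
  set S : Fin K → Matrix (Fin m) (Fin m) ℝ := fun l => Matrix.diagonal fun i => c i l with hS
  have hSsymm : ∀ l, (S l).IsSymm := fun l => Matrix.isSymm_diagonal _
  have hdet : (∑ l, ((X : ℝ[X]) ^ d l) • (S l).map Polynomial.C).det = ∏ i, p i := by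
    simp only [hS]
    rw [pencil_diagonal, Matrix.det_diagonal]
  have hle := hlaw S hSsymm
  rw [hdet] at hle
  -- every point is a positive root of the product
  have hroot : ∀ ij, pt ij ∈ ((∏ i, p i).roots.toFinset.filter fun t => 0 < t) := by
    rintro ⟨i, j⟩
    refine Finset.mem_filter.mpr ⟨Multiset.mem_toFinset.mpr ((Polynomial.mem_roots hprod_ne).mpr ?_), hpt_pos _⟩
    rw [Polynomial.IsRoot, Polynomial.eval_prod]
    refine Finset.prod_eq_zero (Finset.mem_univ i) ?_
    simp only [hp, Polynomial.eval_finsetSum, Polynomial.eval_mul, Polynomial.eval_pow, Polynomial.eval_X, Polynomial.eval_C]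
    exact hc i j
  have hcard : m * (K - 1) ≤ ((∏ i, p i).roots.toFinset.filter fun t => 0 < t).card := by
    have h1 : (Finset.univ.image pt).card = m * (K - 1) := by
      rw [Finset.card_image_of_injective _ hpt_inj, Finset.card_univ, Fintype.card_prod, Fintype.card_fin, Fintype.card_fin]
    rw [← h1]
    exact Finset.card_le_card fun x hx => by
      obtain ⟨ij, _, rfl⟩ := Finset.mem_image.mp hx
      exact hroot ij
  have hmk : 1 ≤ m * (K - 1) := Nat.one_le_iff_ne_zero.mpr (Nat.mul_ne_zero (by omega) (by omega))
  omega

/-- **`m = 1`: Descartes' bound `K − 1` is attained on every support** — `¬ PosRootLawOn 1 K (K − 2) d`. [this work] -/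
theorem not_posRootLawOn_one (hK : 2 ≤ K) {d : Fin K → ℕ} (hd : Function.Injective d) : ¬ PosRootLawOn 1 K (K - 2) d := by
  have h := not_posRootLawOn_diagonal (m := 1) le_rfl hK hd
  rwa [one_mul, show K - 1 - 1 = K - 2 from rfl] at h

/-- positive form: any valid class budget on an injective support with `K ≥ 2` letters is at least `m·(K−1)`. [this work] -/
theorem le_of_posRootLawOn {m B : ℕ} (hm : 1 ≤ m) (hK : 2 ≤ K) {d : Fin K → ℕ} (hd : Function.Injective d)
    (h : PosRootLawOn m K B d) : m * (K - 1) ≤ B := by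
  by_contra hB
  rw [not_le] at hB
  exact not_posRootLawOn_diagonal hm hK hd (fun S hS => (h S hS).trans (by omega))

end Summit.ValiantsHypothesis.ValiantsHypothesis.Theorems.LacunarySymmetroidMatrixDescartes.DescartesSharp
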